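import Mathlib
import Summits.KontsevichZagierPeriods.Zeta5Search.CellKitLevel
import Summits.KontsevichZagierPeriods.Zeta5Search.RayAtlasCellsX
import Summits.KontsevichZagierPeriods.Zeta5Search.FamilyCellAAtlas
import HarnessLib

/-!
# ζ(5) search — CELL KIT, part 4: pair vectors from types, and the LINEAR RAYS `n·(β₀; c+6,…,c)` in omega-friendly form

Cell `pub-zeta5` (HONEST FRAMING: systematic search; no irrationality claim unless certified), P1 prover seat generation 7.
§1 The pair vector of a typed level class: `α_x = ŵ(T) + ε ŵ(T^rev)`, `β_x = v̂(T) + ε v̂(T^rev)` (`pair_of_type`), and the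
vanishing for palindromic types with `ε = −1` (`pair_zero_of_pal`).
§2 Every ray of the atlases (record `bRec`, NEAR-MISSES rows `bFam t`, X-rays `bX1Ray/bX2Ray/bX3Ray`) is a LINEAR RAY
`bLin a e n = (2a + 12n + e; a+6n, a+5n, …, a)` (`a` = least parameter, `e` = excess of `β₀` over `2a + 12n`):
`bRec n = bLin (11n) (7n) n`, `bFam t n = bLin (tn) ((t−4)n) n`, `bX1Ray n = bLin (16n) (17n) n`, `bX2Ray n = bLin (12n) (13n) n`,
`bX3Ray n = bLin (14n) (15n) n`.  Its depth `blockCount` is a staircase (seven closed blocks `[a+in, a+(12−i)n+e]`), so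
`netExp (bLin a e n) q = 1 − depth + [2q = 2a+12n+e]` with the bracket lemmas `depL_low/lower/well/upper/high` — all statements
LINEAR in `a, e, n, q`, so that the per-cell atlases are `omega` problems.  Polytope membership of the ray and of its `e₇`-shift.
Combinatorics only; nothing about irrationality.
-/

noncomputable section

open Finset

namespace Summit.KontsevichZagierPeriods.Zeta5Search.CellKit

open Summit.KontsevichZagierPeriods.Zeta5Search.DualSeries (InBox)
open Summit.KontsevichZagierPeriods.Zeta5Search.CasoratianValuation (InPolytope shift)
open Summit.KontsevichZagierPeriods.Zeta5Search.ClusterValuation (netExp classSet CentreIn classExp conjClass blockCount bRec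
  centreIn_conj_iff)
open Summit.KontsevichZagierPeriods.Zeta5Search.BigPrime (block shift_zero)
open Summit.KontsevichZagierPeriods.Zeta5Search.CellA (wHat vHat)
open Summit.KontsevichZagierPeriods.Zeta5Search.CellAtlas (bFam)
open Summit.KontsevichZagierPeriods.Zeta5Search.RayAtlas (bX1Ray bX2Ray bX3Ray)
open Summit.KontsevichZagierPeriods.Zeta5Search.LevelClass

/-! ### §1 Pair vectors from types -/

section Types

variable {p : ℕ} [hp : Fact p.Prime]
variable (b : ℕ → ℤ) {x L : ℕ} (hx : x < p) (hL : x + L * p ≤ (b 0).toNat) (hL' : (b 0).toNat < x + L * p + p)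

include hx hL hL' in
/-- **The pair vector of a typed, centre-free level class**: `α_x = ŵ(T) + (−1)^{m+1} ŵ(T^rev)`, `β_x = v̂(T) + (−1)^{m+1} v̂(T^rev)`. -/
theorem pair_of_type (hb : InPolytope b) (m : ℤ) (e : ℕ → ℤ) (he : ∀ k ≤ L, netExp b (x + k * p) = e k)
    (hc : ¬ CentreIn b p x) :
    (wHat b p x + (-1 : ℚ) ^ (m + 1) * wHat b p (conjClass b p x)) =
      typeW L e + (-1 : ℚ) ^ (m + 1) * typeW L (fun k => e (L - k)) ∧
    (vHat b p x + (-1 : ℚ) ^ (m + 1) * vHat b p (conjClass b p x)) =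
      typeV L e + (-1 : ℚ) ^ (m + 1) * typeV L (fun k => e (L - k)) := by
  rw [wHat_level b hx hL hL' e he hc, vHat_level b hx hL hL' e he hc, wHat_conj_level b hx hL hL' hb e he hc,
    vHat_conj_level b hx hL hL' hb e he hc]
  exact ⟨rfl, rfl⟩

include hx hL hL' in
/-- **Palindromic types with `(−1)^{m+1} = −1` have zero pair vector.** -/
theorem pair_zero_of_pal (hb : InPolytope b) {m : ℤ} (hm : (-1 : ℚ) ^ (m + 1) = -1) (e : ℕ → ℤ)
    (he : ∀ k ≤ L, netExp b (x + k * p) = e k) (hpal : ∀ k ≤ L, e (L - k) = e k) (hc : ¬ CentreIn b p x) :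
    (wHat b p x + (-1 : ℚ) ^ (m + 1) * wHat b p (conjClass b p x)) = 0 ∧
    (vHat b p x + (-1 : ℚ) ^ (m + 1) * vHat b p (conjClass b p x)) = 0 := by
  obtain ⟨h1, h2⟩ := hat_conj_of_pal b hx hL hL' hb e he hpal hc
  rw [h1, h2, hm]
  exact ⟨by ring, by ring⟩

/-- `(−1)^{m+1} = −1` for even `m`. -/
theorem neg_one_zpow_succ_of_even {m : ℤ} (hm : Even m) : (-1 : ℚ) ^ (m + 1) = -1 := by
  rw [zpow_add₀ (by norm_num), hm.neg_one_zpow, zpow_one]; norm_num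

/-- `(−1)^{m+1} = 1` for odd `m`. -/
theorem neg_one_zpow_succ_of_odd {m : ℤ} (hm : Odd m) : (-1 : ℚ) ^ (m + 1) = 1 := by
  rw [zpow_add₀ (by norm_num), hm.neg_one_zpow, zpow_one]; norm_num

end Types

/-! ### §2 Linear rays -/

/-- **The linear ray** `(2a + 12n + e; a+6n, a+5n, a+4n, a+3n, a+2n, a+n, a)`. -/
def bLin (a e n : ℕ) : ℕ → ℤ := fun i =>
  ((([2 * a + 12 * n + e, a + 6 * n, a + 5 * n, a + 4 * n, a + 3 * n, a + 2 * n, a + n, a] : List ℕ).getD i 0 : ℕ) : ℤ)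

/-- `b₀ = 2a + 12n + e`. -/
theorem bLin_zero (a e n : ℕ) : bLin a e n 0 = ((2 * a + 12 * n + e : ℕ) : ℤ) := by simp [bLin]

/-- `b₀` as a natural number. -/
theorem bLin_zero_toNat (a e n : ℕ) : (bLin a e n 0).toNat = 2 * a + 12 * n + e := by
  rw [bLin_zero]; exact Int.toNat_natCast _

/-- The lower parameters as integers. -/
theorem bLin_succ (a e n j : ℕ) (hj : j < 7) : bLin a e n (j + 1) = ((a + (6 - j) * n : ℕ) : ℤ) := by
  interval_cases j <;> simp [bLin]

/-- The lower parameters: `b_{j+1} = a + (6 − j)n`, `j < 7`. -/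
theorem bLin_succ_toNat (a e n j : ℕ) (hj : j < 7) : (bLin a e n (j + 1)).toNat = a + (6 - j) * n := by
  rw [bLin_succ a e n j hj, Int.toNat_natCast]

/-- `b₇ = a`. -/
theorem bLin_seven_toNat (a e n : ℕ) : (bLin a e n 7).toNat = a := by
  rw [bLin_succ a e n 6 (by norm_num), Int.toNat_natCast]; omega

/-- `b₀ − b₇ = a + 12n + e`. -/
theorem bLin_zero_sub_seven_toNat (a e n : ℕ) : (bLin a e n 0).toNat - (bLin a e n 7).toNat = a + 12 * n + e := by
  rw [bLin_zero_toNat, bLin_seven_toNat]; omega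

/-- Membership of `q` in the `j`-th block of a linear ray, linearly. -/
theorem mem_block_bLin_iff (a e n q j : ℕ) (hj : j < 7) :
    q ∈ block (2 * a + 12 * n + e) (bLin a e n (j + 1)).toNat ↔ a + (6 - j) * n ≤ q ∧ q ≤ a + (6 + j) * n + e := by
  rw [bLin_succ_toNat a e n j hj]
  simp only [block, mem_Icc]
  interval_cases j <;> omega

/-- **The depth of a linear ray as an indicator sum** over the seven closed blocks `[a + (6−j)n, a + (6+j)n + e]`. -/
theorem blockCount_bLin (a e n q : ℕ) :
    blockCount (bLin a e n) q = ∑ j ∈ range 7, if a + (6 - j) * n ≤ q ∧ q ≤ a + (6 + j) * n + e then 1 else 0 := by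
  unfold blockCount
  rw [bLin_zero_toNat, card_filter]
  exact sum_congr rfl fun j hj => if_congr (mem_block_bLin_iff a e n q j (mem_range.1 hj)) rfl rfl

/-- **Net exponents on a linear ray**: `netExp (bLin a e n) q = 1 − depth + [2q = 2a + 12n + e]`. -/
theorem netExp_bLin (a e n q : ℕ) :
    netExp (bLin a e n) q = 1 - (blockCount (bLin a e n) q : ℤ) + (if 2 * q = 2 * a + 12 * n + e then 1 else 0) := by
  unfold netExp
  rw [bLin_zero]
  have : (2 * (q : ℤ) = ((2 * a + 12 * n + e : ℕ) : ℤ)) ↔ 2 * q = 2 * a + 12 * n + e := by omega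
  simp only [this]

/-- Net exponent away from the centre. -/
theorem netExp_bLin_of_ne {a e n q : ℕ} (hc : 2 * q ≠ 2 * a + 12 * n + e) :
    netExp (bLin a e n) q = 1 - (blockCount (bLin a e n) q : ℤ) := by
  rw [netExp_bLin, if_neg hc, add_zero]

/-- Net exponent at the (even) centre. -/
theorem netExp_bLin_centre {a e n q : ℕ} (hc : 2 * q = 2 * a + 12 * n + e) :
    netExp (bLin a e n) q = 2 - (blockCount (bLin a e n) q : ℤ) := by
  rw [netExp_bLin, if_pos hc]; ring

/-- Below all blocks: depth `0`. -/
theorem depL_low {a e n q : ℕ} (h : q < a) : blockCount (bLin a e n) q = 0 := by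
  rw [blockCount_bLin]; simp only [sum_range_succ, sum_range_zero, zero_add]; split_ifs <;> omega

/-- Above all blocks: depth `0`. -/
theorem depL_high {a e n q : ℕ} (h : a + 12 * n + e < q) : blockCount (bLin a e n) q = 0 := by
  rw [blockCount_bLin]; simp only [sum_range_succ, sum_range_zero, zero_add]; split_ifs <;> omega

/-- Lower staircase: depth `k` on `[a + (k−1)n, a + kn)`, `1 ≤ k ≤ 6`. -/
theorem depL_lower {a e n q k : ℕ} (hk1 : 1 ≤ k) (hk : k ≤ 6) (h1 : a + (k - 1) * n ≤ q) (h2 : q < a + k * n) :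
    blockCount (bLin a e n) q = k := by
  rw [blockCount_bLin]; simp only [sum_range_succ, sum_range_zero, zero_add]
  interval_cases k <;> split_ifs <;> omega

/-- The well: depth `7` on `[a + 6n, a + 6n + e]`. -/
theorem depL_well {a e n q : ℕ} (h1 : a + 6 * n ≤ q) (h2 : q ≤ a + 6 * n + e) : blockCount (bLin a e n) q = 7 := by
  rw [blockCount_bLin]; simp only [sum_range_succ, sum_range_zero, zero_add]; split_ifs <;> omega

/-- Upper staircase: depth `k` on `(a + (12−k)n + e, a + (13−k)n + e]`, `1 ≤ k ≤ 6`. -/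
theorem depL_upper {a e n q k : ℕ} (hk1 : 1 ≤ k) (hk : k ≤ 6) (h1 : a + (12 - k) * n + e < q)
    (h2 : q ≤ a + (13 - k) * n + e) : blockCount (bLin a e n) q = k := by
  rw [blockCount_bLin]; simp only [sum_range_succ, sum_range_zero, zero_add]
  interval_cases k <;> split_ifs <;> omega

/-- **The linear ray lies in the polytope** when `a ≤ 15n + 3e`. -/
theorem inPolytope_bLin {a e n : ℕ} (ha : a ≤ 15 * n + 3 * e) : InPolytope (bLin a e n) := by
  refine ⟨⟨?_, ?_⟩, ?_, ?_⟩
  · rw [bLin_zero]; positivity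
  · intro j hj
    simp only [Finset.mem_range] at hj
    interval_cases j <;> simp [bLin] <;> omega
  · intro j hj
    simp only [Finset.mem_range] at hj
    interval_cases j <;> simp [bLin] <;> omega
  · simp [bLin, Finset.sum_range_succ]; omega

/-- **Its `e₇`-shift lies in the polytope** when `n ≥ 1` and `a < 15n + 3e`. -/
theorem inPolytope_shift_bLin {a e n : ℕ} (hn : 1 ≤ n) (ha : a + 1 ≤ 15 * n + 3 * e) : InPolytope (shift (bLin a e n) 7) := by
  refine ⟨⟨?_, ?_⟩, ?_, ?_⟩
  · rw [shift_zero _ (by norm_num), bLin_zero]; positivity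
  · intro j hj
    simp only [Finset.mem_range] at hj
    interval_cases j <;> simp [shift, bLin, Function.update] <;> omega
  · intro j hj
    simp only [Finset.mem_range] at hj
    interval_cases j <;> simp [shift, bLin, Function.update] <;> omega
  · simp [shift, bLin, Function.update, Finset.sum_range_succ]; omega

/-- `(b + e₇)₀ = b₀`. -/
theorem shift_bLin_zero_toNat (a e n : ℕ) : (shift (bLin a e n) 7 0).toNat = 2 * a + 12 * n + e := by
  rw [shift_zero _ (by norm_num), bLin_zero_toNat]

/-! ### §3 The rays of the atlases are linear rays -/

/-- The record ray: `bRec n = bLin (11n) (7n) n`. -/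
theorem bRec_eq_bLin (n : ℕ) : bRec n = bLin (11 * n) (7 * n) n := by
  funext i
  rcases i with _ | _ | _ | _ | _ | _ | _ | _ | i <;> simp [bRec, bLin] <;> ring

/-- The NEAR-MISSES rows: `bFam t n = bLin (tn) ((t−4)n) n` for `t ≥ 4`. -/
theorem bFam_eq_bLin {t : ℕ} (ht : 4 ≤ t) (n : ℕ) : bFam t n = bLin (t * n) ((t - 4) * n) n := by
  funext i
  obtain ⟨s, rfl⟩ : ∃ s, t = s + 4 := ⟨t - 4, by omega⟩
  rw [Nat.add_sub_cancel]
  rcases i with _ | _ | _ | _ | _ | _ | _ | _ | i <;> simp [bFam, bLin] <;> ring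

/-- The X1 ray: `bX1Ray n = bLin (16n) (17n) n`. -/
theorem bX1Ray_eq_bLin (n : ℕ) : bX1Ray n = bLin (16 * n) (17 * n) n := by
  funext i
  rcases i with _ | _ | _ | _ | _ | _ | _ | _ | i <;> simp [bX1Ray, bLin] <;> ring

/-- The X2 ray: `bX2Ray n = bLin (12n) (13n) n`. -/
theorem bX2Ray_eq_bLin (n : ℕ) : bX2Ray n = bLin (12 * n) (13 * n) n := by
  funext i
  rcases i with _ | _ | _ | _ | _ | _ | _ | _ | i <;> simp [bX2Ray, bLin] <;> ring

/-- The X3 ray: `bX3Ray n = bLin (14n) (15n) n`. -/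
theorem bX3Ray_eq_bLin (n : ℕ) : bX3Ray n = bLin (14 * n) (15 * n) n := by
  funext i
  rcases i with _ | _ | _ | _ | _ | _ | _ | _ | i <;> simp [bX3Ray, bLin] <;> ring

end Summit.KontsevichZagierPeriods.Zeta5Search.CellKit

end
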